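import Literature.Analysis.FluidPDE.KatoLaiPeriodicCylinder
import Literature.Analysis.FluidPDE.PressurePoisson
import HarnessLib

/-!
# Calculus of fields that are jointly `C¹` on `S × K` (time set × closed spatial domain)

Topic `Literature/Analysis/FluidPDE`. Toolkit for classical solutions of evolution equations on
a domain with boundary, whose velocity `u : ℝ → X → F` is `Cⁿ` **jointly** on `S ×ˢ K` only
(`S` a time set such as `[0, T)`, `K` a closed spatial domain such as the closed cylinder), as in
`IsClassicalEulerOnDomain` / `IsPeriodicCylinderEulerSolution`: the one-sided time derivative
`timeDerivWithin S u` and the spatial derivative of a slice `u s` are read off the joint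
derivative `D = fderivWithin ℝ (uncurry u) (S ×ˢ K)`, which is continuous on `S ×ˢ K`; hence
`∂ₜu` is jointly continuous up to the boundary and the slices have derivative `D ∘ inr` at
interior points, with the norm bound `‖D(u s)(x)‖ ≤ ‖D(s, x)‖`. The whole-space versions
(`K = univ`) are in `SpaceTimeCalculusC1` (`hasFDerivAt_slice_of_contDiffOn`, …; here the
`S × K` analogues carry the suffix `_prod`) and `ClassicalSolutionCalculus`; the slice/restriction
lemmas for `S × K` are in `ChenHouContinuation` (`differentiableWithinAt_time_of_contDiffOn`, …).

Also recorded (with the product rules `divergence_smul_apply` of `WholeSpaceIBP` and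
`divergence_add_apply` of `PressurePoisson`): the **pointwise energy identity** for the difference of two classical Euler solutions,
`2⟪w, ∂ₜw⟫ = −div(⟪w,w⟫ u₁ + 2π w) − 2⟪w, Du₂ w⟫` (`w = u₁ − u₂`, `π = p₁ − p₂`), the integrand
form of Kato–Lai's `dₜ‖u − v‖₀² = 2(u − v | dₜ(u − v))₀` (1984, p. 23) before integration by
parts. All statements are folklore calculus.
-/

noncomputable section

open MeasureTheory Set Function Filter Topology TopologicalSpace
open scoped ContDiff NNReal ENNReal InnerProductSpace RealInnerProductSpace

namespace Literature.Analysis.FluidPDE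

/-! ### Joint derivatives on `S × K` -/

section Joint

variable {X : Type*} [NormedAddCommGroup X] [NormedSpace ℝ X]
variable {F : Type*} [NormedAddCommGroup F] [NormedSpace ℝ F]
variable {S : Set ℝ} {K : Set X} {w : ℝ → X → F} {n : WithTop ℕ∞}

/-- The joint derivative within `S × K` exists at every point of `S × K`. [folklore] -/
theorem hasFDerivWithinAt_uncurry_of_contDiffOn_prod (h : ContDiffOn ℝ n (uncurry w) (S ×ˢ K))
    (hn : n ≠ 0) {s : ℝ} (hs : s ∈ S) {x : X} (hx : x ∈ K) :
    HasFDerivWithinAt (uncurry w) (fderivWithin ℝ (uncurry w) (S ×ˢ K) (s, x)) (S ×ˢ K) (s, x) :=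
  (h.differentiableOn hn (s, x) (mk_mem_prod hs hx)).hasFDerivWithinAt

/-- The time line through a point of `S × K` has derivative `D(s,x)(1,0)` within `S`. [folklore] -/
theorem hasDerivWithinAt_time_fderivWithin (h : ContDiffOn ℝ n (uncurry w) (S ×ˢ K)) (hn : n ≠ 0)
    {s : ℝ} (hs : s ∈ S) {x : X} (hx : x ∈ K) :
    HasDerivWithinAt (fun σ => w σ x) (fderivWithin ℝ (uncurry w) (S ×ˢ K) (s, x) (1, 0)) S s := by
  have h1 := hasFDerivWithinAt_uncurry_of_contDiffOn_prod h hn hs hx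
  have h2 : HasDerivWithinAt (fun σ : ℝ => ((σ, x) : ℝ × X)) ((1 : ℝ), (0 : X)) S s :=
    (hasDerivWithinAt_id s S).prodMk (hasDerivWithinAt_const s S x)
  exact h1.comp_hasDerivWithinAt s h2 fun σ hσ => mk_mem_prod hσ hx

/-- **The one-sided time derivative is a component of the joint derivative**:
`∂ₜu(s, x) = D(s, x)(1, 0)` on `S × K` for `S` of unique differentiability. [folklore] -/
theorem timeDerivWithin_eq_fderivWithin_uncurry (h : ContDiffOn ℝ n (uncurry w) (S ×ˢ K))
    (hn : n ≠ 0) (hS : UniqueDiffOn ℝ S) {s : ℝ} (hs : s ∈ S) {x : X} (hx : x ∈ K) :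
    timeDerivWithin S w s x = fderivWithin ℝ (uncurry w) (S ×ˢ K) (s, x) (1, 0) :=
  (hasDerivWithinAt_time_fderivWithin h hn hs hx).derivWithin (hS s hs)

/-- **The time derivative is jointly continuous up to the boundary**: for `u` jointly `Cⁿ`,
`n ≥ 1`, on `S × K` (both of unique differentiability), `(s, x) ↦ ∂ₜu(s, x)` is continuous on
`S × K`. [folklore] -/
theorem continuousOn_uncurry_timeDerivWithin (h : ContDiffOn ℝ n (uncurry w) (S ×ˢ K))
    (hn : 1 ≤ n) (hS : UniqueDiffOn ℝ S) (hK : UniqueDiffOn ℝ K) :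
    ContinuousOn (uncurry (timeDerivWithin S w)) (S ×ˢ K) := by
  have hn0 : n ≠ 0 := by
    rintro rfl
    exact not_lt.2 hn zero_lt_one
  have hc : ContinuousOn (fun z : ℝ × X => fderivWithin ℝ (uncurry w) (S ×ˢ K) z ((1 : ℝ), (0 : X)))
      (S ×ˢ K) :=
    (h.continuousOn_fderivWithin (hS.prod hK) hn).clm_apply continuousOn_const
  refine hc.congr ?_
  rintro ⟨s, x⟩ ⟨hs, hx⟩
  exact timeDerivWithin_eq_fderivWithin_uncurry h hn0 hS hs hx

/-- At a time `s` with `S ∈ 𝓝 s` (an interior time) the time line is differentiable in the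
two-sided sense, with derivative `∂ₜu(s, x)`. [folklore] -/
theorem hasDerivAt_time_of_contDiffOn (h : ContDiffOn ℝ n (uncurry w) (S ×ˢ K)) (hn : n ≠ 0)
    (hS : UniqueDiffOn ℝ S) {s : ℝ} (hs : s ∈ S) (hSs : S ∈ 𝓝 s) {x : X} (hx : x ∈ K) :
    HasDerivAt (fun σ => w σ x) (timeDerivWithin S w s x) s := by
  rw [timeDerivWithin_eq_fderivWithin_uncurry h hn hS hs hx]
  exact (hasDerivWithinAt_time_fderivWithin h hn hs hx).hasDerivAt hSs

/-- **Slices are differentiable at interior points of `K`**, with derivative the spatial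
component `D(s, x) ∘ inr` of the joint derivative. [folklore] -/
theorem hasFDerivAt_slice_of_contDiffOn_prod (h : ContDiffOn ℝ n (uncurry w) (S ×ˢ K)) (hn : n ≠ 0)
    {s : ℝ} (hs : s ∈ S) {x : X} (hxK : x ∈ K) (hKx : K ∈ 𝓝 x) :
    HasFDerivAt (w s)
      ((fderivWithin ℝ (uncurry w) (S ×ˢ K) (s, x)).comp (ContinuousLinearMap.inr ℝ ℝ X)) x := by
  have h1 := hasFDerivWithinAt_uncurry_of_contDiffOn_prod h hn hs hxK
  have h2 : HasFDerivWithinAt (fun y : X => ((s, y) : ℝ × X)) (ContinuousLinearMap.inr ℝ ℝ X) K x :=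
    (hasFDerivAt_prodMk_right s x).hasFDerivWithinAt
  exact (h1.comp x h2 fun y hy => ⟨hs, hy⟩).hasFDerivAt hKx

/-- The slice derivative at an interior point, as an `fderiv`. [folklore] -/
theorem fderiv_slice_of_contDiffOn (h : ContDiffOn ℝ n (uncurry w) (S ×ˢ K)) (hn : n ≠ 0)
    {s : ℝ} (hs : s ∈ S) {x : X} (hxK : x ∈ K) (hKx : K ∈ 𝓝 x) :
    fderiv ℝ (w s) x =
      (fderivWithin ℝ (uncurry w) (S ×ˢ K) (s, x)).comp (ContinuousLinearMap.inr ℝ ℝ X) :=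
  (hasFDerivAt_slice_of_contDiffOn_prod h hn hs hxK hKx).fderiv

/-- **Norm bound for the slice derivative** by the joint derivative:
`‖D(u s)(x)‖ ≤ ‖D(s, x)‖` at interior points. [folklore] -/
theorem norm_fderiv_slice_le (h : ContDiffOn ℝ n (uncurry w) (S ×ˢ K)) (hn : n ≠ 0)
    {s : ℝ} (hs : s ∈ S) {x : X} (hxK : x ∈ K) (hKx : K ∈ 𝓝 x) :
    ‖fderiv ℝ (w s) x‖ ≤ ‖fderivWithin ℝ (uncurry w) (S ×ˢ K) (s, x)‖ := by
  rw [fderiv_slice_of_contDiffOn h hn hs hxK hKx]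
  refine (ContinuousLinearMap.opNorm_comp_le _ _).trans ?_
  have := ContinuousLinearMap.norm_inr_le_one ℝ ℝ X
  exact mul_le_of_le_one_right (norm_nonneg _) this

end Joint

/-! ### Product rules for the divergence -/

section Divergence

variable {E : Type*} [NormedAddCommGroup E] [InnerProductSpace ℝ E] [FiniteDimensional ℝ E]

omit [FiniteDimensional ℝ E] in
/-- `⟪v, ∇q(x)⟫ = Dq(x) v` (Riesz representation; a local copy of the one-liner
`inner_gradient_right_eq_fderiv` of `LerayHopfProofs`, not imported here). [folklore] -/
private theorem inner_gradient_right_eq_fderiv' [CompleteSpace E] (q : E → ℝ) (x v : E) :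
    ⟪v, gradient q x⟫ = fderiv ℝ q x v := by
  rw [real_inner_comm, gradient, InnerProductSpace.toDual_symm_apply]

omit [FiniteDimensional ℝ E] in
/-- The derivative of `y ↦ ⟪w y, w y⟫` is `v ↦ 2⟪w x, Dw(x) v⟫`. [folklore] -/
theorem fderiv_inner_self_apply {w : E → E} {x : E} (hw : DifferentiableAt ℝ w x) (v : E) :
    fderiv ℝ (fun y => ⟪w y, w y⟫) x v = 2 * ⟪w x, fderiv ℝ w x v⟫ := by
  rw [fderiv_inner_apply ℝ hw hw, real_inner_comm (fderiv ℝ w x v)]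
  ring

/-- **Pointwise energy identity for the difference of two Euler solutions** (the integrand of
Kato–Lai's `dₜ‖u − v‖₀² = 2(u − v | dₜ(u − v))₀`, 1984 p. 23, before integrating by parts): if
`a' = −∇P₁ − (a·∇)a`, `b' = −∇P₂ − (b·∇)b` at `x` and `div a = div b = 0` there, then with
`w = a − b`, `π = P₁ − P₂`,
`2⟪w, a' − b'⟫ = −div(⟪w, w⟫ a + 2π w)(x) − 2⟪w, Db(x) w⟫`,
because `(a·∇)a − (b·∇)b = (a·∇)w + (w·∇)b`, `div(⟪w,w⟫ a) = 2⟪w, (a·∇)w⟫ + ⟪w,w⟫ div a` and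
`div(2π w) = 2⟪∇π, w⟫ + 2π div w`. The divergence term integrates to zero over a period cell
for fields tangential on the wall (`setIntegral_mul_divergence_cylCoord_eq_zero`). [folklore] -/
theorem two_mul_inner_sub_timeDeriv_eq {a b a' b' : E → E} {P₁ P₂ : E → ℝ} {x : E}
    (ha : DifferentiableAt ℝ a x) (hb : DifferentiableAt ℝ b x) (hP₁ : DifferentiableAt ℝ P₁ x)
    (hP₂ : DifferentiableAt ℝ P₂ x)
    (hma : a' x = -gradient P₁ x - fderiv ℝ a x (a x))
    (hmb : b' x = -gradient P₂ x - fderiv ℝ b x (b x))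
    (hdiva : VectorCalculus.divergence a x = 0) (hdivb : VectorCalculus.divergence b x = 0) :
    2 * ⟪a x - b x, a' x - b' x⟫ =
      -VectorCalculus.divergence
          (fun y => ⟪a y - b y, a y - b y⟫ • a y + (2 * (P₁ y - P₂ y)) • (a y - b y)) x -
        2 * ⟪a x - b x, fderiv ℝ b x (a x - b x)⟫ := by
  have hw : DifferentiableAt ℝ (fun y => a y - b y) x := ha.sub hb
  have hφ : DifferentiableAt ℝ (fun y => ⟪a y - b y, a y - b y⟫) x := hw.inner ℝ hw
  have hdP : DifferentiableAt ℝ (fun y => P₁ y - P₂ y) x := hP₁.sub hP₂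
  have hπ : DifferentiableAt ℝ (fun y => 2 * (P₁ y - P₂ y)) x := hdP.const_mul 2
  have h1 : DifferentiableAt ℝ (fun y => ⟪a y - b y, a y - b y⟫ • a y) x := hφ.smul ha
  have h2 : DifferentiableAt ℝ (fun y => (2 * (P₁ y - P₂ y)) • (a y - b y)) x := hπ.smul hw
  rw [divergence_add_apply h1 h2, divergence_smul_apply hφ ha, divergence_smul_apply hπ hw,
    divergence_sub_apply ha hb, hdiva, hdivb, inner_gradient_right_eq_fderiv',
    inner_gradient_right_eq_fderiv', fderiv_inner_self_apply hw,
    fderiv_const_mul hdP, fderiv_fun_sub hP₁ hP₂, fderiv_fun_sub ha hb]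
  simp only [sub_zero, mul_zero, zero_add, FunLike.coe_smul, Pi.smul_apply,
    FunLike.coe_sub, Pi.sub_apply, smul_eq_mul, hma, hmb, inner_sub_left,
    inner_sub_right, inner_neg_right, map_sub, inner_gradient_right_eq_fderiv']
  ring

end Divergence

end Literature.Analysis.FluidPDE
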